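import Summits.NavierStokesRegularity.NavierStokesRegularity.Theorems.SoloRefuteTsionskiy2025

/-!
# C15 `Tsionskiy2025` — part 4: Theorem 6.3 fails — (6.58)/(6.59) p. 143, `¬ Eq658`, `¬ Step_5`

Cell `ns-claims` (D-0090 NS-CLAIMS SWEEP), claim C15; refuter `ns-claims-refuter-6`; referee
`ns-claims-ref-4`. Text of record [TsionskiyTsionskiy2025]; skeleton
`Literature.Claims.NS.Tsionskiy2025` (p462200, rev 2 p463109). The locator `Step_2` (Thm 6.1
(6.16) p. 135) is refuted in part 2 (`not_Step_2`, of record), `Step_3` (Thm 6.2) in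
`SoloRefuteTsionskiy2025Step3` (salvage-p6) and part 3. This file closes the third operator
theorem of §6, consumed by (7.7) p. 144 (the term `δt|(u⃗·∇)u⃗|`):

* Theorem 6.3, (6.59) p. 143 «|S̿ᵗ·f⃗| < |f⃗|, f⃗ ∈ →TS» (`Step_5`) and its scalar diagonal form
  (6.58) «|Sᵗ_ii(f_i)| < |f_i|» (`Eq658`) are FALSE: the entry
  `S_00 = F⁻¹[χ₀₀ e^{−ν|γ|²(t−t*)} δ(γ) F·]` ((6.46) p. 141) applied to part 2's two-scale witness
  `w(x) = e^{−(ε³/144)|x|²} − 2e^{−315ε³|x|²}` has `(S_00 w)(0) = (2/3)·(B_{t−t*} w)(0) ≤ −16/15`,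
  so `‖S_00 w‖₀ ≥ 16/15 > 1 = ‖w‖₀`, for EVERY `ν ≥ 0`, `ε > 0`, lag `t − t* ≥ 0` with
  `ν(t−t*)ε³ ≤ 1/63000`; vector instance `f⃗ = (w, 0, 0)`; closed instance `ν = 1`, `ε = e^{−2}`,
  `t = e^{−6}`, `t* = e^{−6}/2`.
* The factor `2/3` is the direction average of the Leray multiplier `χ₀₀(γ) = 1 − γ₀²/|γ|²`
  against a radial weight (Part F: `∫ γ_k²/|γ|² R` is independent of `k` by the coordinate-swap
  isometries, which preserve Lebesgue measure, and the three sum to `∫ R`).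
* Same mechanism as Theorems 6.1/6.2 (zero-mean / near-identity multiplier kernels do not
  contract the sup norm); the typist's flag on `Step_5` is confirmed in the kernel. The locator of
  the row stays `Step_2` (part 2).

Closed terms; axioms `propext`, `Classical.choice`, `Quot.sound`.

WHAT THIS IS NOT: not a claim about NS regularity or blow-up; not a claim about any author beyond
the typed locator.
-/

-- The summit's canonical theorem namespace repeats the summit name (single-conjunct summit).
set_option linter.dupNamespace false

noncomputable section

open MeasureTheory Real Filter Topology Set
open scoped RealInnerProductSpace FourierTransform ContDiff SchwartzMap

namespace Summit.NavierStokesRegularity.NavierStokesRegularity.Theorems.Tsionskiy2025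

section Toolkit

open Literature.Claims.NS.Tsionskiy2025

/-! ## Part F — direction averaging: `∫ χ₀₀ R = (2/3) ∫ R` for swap-invariant weights -/

/-- The coordinate swap `0 ↔ k` as a linear isometry of `E3`. -/
def swapIso (k : Fin 3) : E3 ≃ₗᵢ[ℝ] E3 :=
  LinearIsometryEquiv.piLpCongrLeft 2 ℝ ℝ (Equiv.swap (0 : Fin 3) k)

/-- Coordinates of the swapped vector. -/
lemma swapIso_apply (k : Fin 3) (ξ : E3) (i : Fin 3) :
    swapIso k ξ i = ξ (Equiv.swap (0 : Fin 3) k i) := by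
  simp [swapIso, LinearIsometryEquiv.piLpCongrLeft_apply, Equiv.piCongrLeft'_apply,
    Equiv.symm_swap]

/-- The `0`-th coordinate of the swapped vector is the `k`-th coordinate. -/
lemma swapIso_apply_zero (k : Fin 3) (ξ : E3) : swapIso k ξ 0 = ξ k := by
  rw [swapIso_apply, Equiv.swap_apply_left]

/-- The swap preserves the norm. -/
lemma norm_swapIso (k : Fin 3) (ξ : E3) : ‖swapIso k ξ‖ = ‖ξ‖ := (swapIso k).norm_map ξ

/-- The swap fixes only what it should: `swapIso k ξ = 0 ↔ ξ = 0`. -/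
lemma swapIso_eq_zero_iff (k : Fin 3) (ξ : E3) : swapIso k ξ = 0 ↔ ξ = 0 :=
  (swapIso k).injective.eq_iff' (map_zero _)

/-- Second moments of a swap-invariant weight are direction independent:
`∫ ξ_k²/|ξ|² R = ∫ ξ_0²/|ξ|² R`. -/
lemma integral_coord_sq_eq (k : Fin 3) (R : E3 → ℝ) (hR : ∀ ξ, R (swapIso k ξ) = R ξ) :
    ∫ ξ : E3, (ξ k) ^ 2 / ‖ξ‖ ^ 2 * R ξ = ∫ ξ : E3, (ξ 0) ^ 2 / ‖ξ‖ ^ 2 * R ξ := by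
  have hmp : MeasurePreserving (swapIso k) volume volume := (swapIso k).measurePreserving
  have hme : MeasurableEmbedding (swapIso k) :=
    (swapIso k).toContinuousLinearEquiv.toHomeomorph.measurableEmbedding
  have := hmp.integral_comp hme (fun ξ : E3 => (ξ 0) ^ 2 / ‖ξ‖ ^ 2 * R ξ)
  simp only [swapIso_apply_zero, norm_swapIso, hR] at this
  exact this

/-- `∑_k ξ_k² / |ξ|² = 1` off the origin (and `= 0` at it). -/
lemma sum_coord_sq_div (ξ : E3) :
    ∑ k : Fin 3, (ξ k) ^ 2 / ‖ξ‖ ^ 2 = if ξ = 0 then 0 else 1 := by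
  rw [← Finset.sum_div, ← EuclideanSpace.real_norm_sq_eq]
  split_ifs with h
  · simp [h]
  · exact div_self (pow_ne_zero 2 (norm_ne_zero_iff.mpr h))

/-- `ξ ↦ ξ_k²/|ξ|²` is measurable. -/
lemma measurable_coord_sq_div (k : Fin 3) : Measurable (fun ξ : E3 => (ξ k) ^ 2 / ‖ξ‖ ^ 2) :=
  ((EuclideanSpace.proj k).continuous.measurable.pow_const 2).div
    (continuous_norm.measurable.pow_const 2)

/-- `0 ≤ ξ_k²/|ξ|² ≤ 1`. -/
lemma coord_sq_div_mem (k : Fin 3) (ξ : E3) :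
    0 ≤ (ξ k) ^ 2 / ‖ξ‖ ^ 2 ∧ (ξ k) ^ 2 / ‖ξ‖ ^ 2 ≤ 1 := by
  refine ⟨by positivity, ?_⟩
  by_cases h : ξ = 0
  · simp [h]
  · rw [div_le_one (by positivity), EuclideanSpace.real_norm_sq_eq]
    exact Finset.single_le_sum (f := fun i => (ξ i) ^ 2) (fun i _ => sq_nonneg _)
      (Finset.mem_univ k)

/-- `ξ_k²/|ξ|² · R` is integrable when `R` is. -/
lemma integrable_coord_sq_div_mul (k : Fin 3) {R : E3 → ℝ} (hint : Integrable R) :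
    Integrable (fun ξ : E3 => (ξ k) ^ 2 / ‖ξ‖ ^ 2 * R ξ) :=
  hint.bdd_mul (c := 1) (measurable_coord_sq_div k).aestronglyMeasurable
    (ae_of_all _ fun ξ => by
      rw [Real.norm_eq_abs, abs_of_nonneg (coord_sq_div_mem k ξ).1]; exact (coord_sq_div_mem k ξ).2)

/-- `∫ ξ_0²/|ξ|² R = (1/3) ∫ R` for an integrable weight invariant under the coordinate swaps and
vanishing at the origin. -/
lemma integral_coord0_sq (R : E3 → ℝ) (hR0 : R 0 = 0) (hR : ∀ k ξ, R (swapIso k ξ) = R ξ)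
    (hint : Integrable R) :
    ∫ ξ : E3, (ξ 0) ^ 2 / ‖ξ‖ ^ 2 * R ξ = (1 / 3) * ∫ ξ : E3, R ξ := by
  have hsum : ∑ k : Fin 3, ∫ ξ : E3, (ξ k) ^ 2 / ‖ξ‖ ^ 2 * R ξ = ∫ ξ : E3, R ξ := by
    rw [← integral_finsetSum _ (fun k _ => integrable_coord_sq_div_mul k hint)]
    refine integral_congr_ae (ae_of_all _ fun ξ => ?_)
    simp only
    rw [← Finset.sum_mul, sum_coord_sq_div]
    split_ifs with h
    · simp [h, hR0]
    · simp
  rw [Fin.sum_univ_three, integral_coord_sq_eq 1 R (hR 1), integral_coord_sq_eq 2 R (hR 2)] at hsum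
  linarith

/-! ## Part G — the diagonal entry `S_00` of `S̿ᵗ` ((6.46)/(6.57) p. 141–143) on the two-scale witness -/

/-- `χ₀₀(γ) = 1 − γ₀²/|γ|²` (value `1` at `γ = 0` on both sides). -/
lemma leray00_eq (γ : E3) : leray 0 0 γ = 1 - (γ 0) ^ 2 / ‖γ‖ ^ 2 := by
  unfold leray
  by_cases h : γ = 0
  · simp [h]
  · simp [h, pow_two]

/-- `χ₀₀` is homogeneous of degree `0`. -/
lemma leray00_smul {c : ℝ} (hc : c ≠ 0) (γ : E3) : leray 0 0 (c • γ) = leray 0 0 γ := by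
  rw [leray00_eq, leray00_eq]
  by_cases h : γ = 0
  · simp [h]
  · have hn : ‖γ‖ ≠ 0 := norm_ne_zero_iff.mpr h
    simp only [PiLp.smul_apply, smul_eq_mul, norm_smul, Real.norm_eq_abs, mul_pow, sq_abs]
    field_simp

/-- `χ₀₀` is even. -/
lemma leray00_even (γ : E3) : leray 0 0 (-γ) = leray 0 0 γ := by
  rw [show -γ = (-1 : ℝ) • γ by simp, leray00_smul (by norm_num)]

/-- `|χ₀₀| ≤ 1`. -/
lemma abs_leray00_le_one (γ : E3) : |leray 0 0 γ| ≤ 1 := by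
  rw [leray00_eq]
  obtain ⟨h0, h1⟩ := coord_sq_div_mem 0 γ
  rw [abs_le]; constructor <;> linarith

/-- The multiplier of `S_00` at time lag `s`: `χ₀₀(γ) e^{−νs|γ|²} δ(γ)` ((6.46) p. 141). -/
def multS (ν s ε : ℝ) (γ : E3) : ℝ := leray 0 0 γ * multB ν s ε γ

/-- The skeleton's `symbS ν s ε 0 0` is `multS ν s ε`. -/
lemma symbS00_eq (ν s ε : ℝ) : symbS ν s ε 0 0 = multS ν s ε := by
  funext γ
  rw [multS, multB, symbS, show -(ν * s) * ‖γ‖ ^ 2 = -(ν * ‖γ‖ ^ 2 * s) by ring]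
  ring

/-- `multS` is even ((6.47) p. 141). -/
lemma multS_even (ν s ε : ℝ) (γ : E3) : multS ν s ε (-γ) = multS ν s ε γ := by
  rw [multS, multS, leray00_even, multB_even]

/-- `|multS| ≤ 1`. -/
lemma abs_multS_le_one {ν s ε : ℝ} (hνs : 0 ≤ ν * s) (hε : 0 ≤ ε) (γ : E3) :
    |multS ν s ε γ| ≤ 1 := by
  rw [multS, abs_mul]
  exact mul_le_one₀ (abs_leray00_le_one γ) (abs_nonneg _) (abs_multB_le_one hνs hε γ)

/-- `ξ ↦ multS(2πξ)` is measurable. -/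
lemma measurable_multS_smul (ν s ε : ℝ) :
    Measurable (fun ξ : E3 => multS ν s ε ((2 * π) • ξ)) := by
  have h : (fun ξ : E3 => multS ν s ε ((2 * π) • ξ))
      = fun ξ => (1 - (ξ 0) ^ 2 / ‖ξ‖ ^ 2) * multB ν s ε ((2 * π) • ξ) := by
    funext ξ; rw [multS, leray00_smul (by positivity : (2 * π : ℝ) ≠ 0), leray00_eq]
  rw [h]
  exact (measurable_const.sub (measurable_coord_sq_div 0)).mul (measurable_multB_smul ν s ε)

/-- The radial weight `m_B(2πξ) Ĝ_a(ξ)` is invariant under the coordinate swaps. -/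
lemma multB_ghat_swap (ν s ε a : ℝ) (k : Fin 3) (ξ : E3) :
    multB ν s ε ((2 * π) • swapIso k ξ) * ghat a (swapIso k ξ)
      = multB ν s ε ((2 * π) • ξ) * ghat a ξ := by
  have h1 : ‖(2 * π) • swapIso k ξ‖ = ‖(2 * π) • ξ‖ := by rw [norm_smul, norm_smul, norm_swapIso]
  have h2 : ((2 * π) • swapIso k ξ = 0) ↔ ((2 * π) • ξ = 0) := by
    rw [smul_eq_zero, smul_eq_zero, swapIso_eq_zero_iff]
  simp only [multB, ghat, cutoff, h1, h2, norm_swapIso]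

/-- Direction averaging of `χ₀₀` against the radial weight: `∫ χ₀₀ m_B Ĝ_a = (2/3) ∫ m_B Ĝ_a`. -/
lemma integral_multS_ghat {ν s ε a : ℝ} (hνs : 0 ≤ ν * s) (hε : 0 ≤ ε) (ha : 0 < a) :
    ∫ ξ : E3, multS ν s ε ((2 * π) • ξ) * ghat a ξ
      = (2 / 3) * ∫ ξ : E3, multB ν s ε ((2 * π) • ξ) * ghat a ξ := by
  set R : E3 → ℝ := fun ξ => multB ν s ε ((2 * π) • ξ) * ghat a ξ with hRdef
  have hint : Integrable R :=
    (integrable_ghat ha).bdd_mul (c := 1) (measurable_multB_smul ν s ε).aestronglyMeasurable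
      (ae_of_all _ fun ξ => abs_multB_le_one hνs hε _)
  have hR0 : R 0 = 0 := by simp [hRdef, multB, cutoff]
  have hRsw : ∀ k ξ, R (swapIso k ξ) = R ξ := fun k ξ => multB_ghat_swap ν s ε a k ξ
  have hsplit : (fun ξ : E3 => multS ν s ε ((2 * π) • ξ) * ghat a ξ)
      = fun ξ => R ξ - (ξ 0) ^ 2 / ‖ξ‖ ^ 2 * R ξ := by
    funext ξ
    rw [hRdef, multS, leray00_smul (by positivity : (2 * π : ℝ) ≠ 0), leray00_eq]
    ring
  rw [hsplit, integral_sub hint (integrable_coord_sq_div_mul 0 hint),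
    integral_coord0_sq R hR0 hRsw hint]
  ring

/-- `(S_00 w)(0) ≤ −16/15` for the two-scale witness whenever `ν s ε³ ≤ 1/63000`. -/
lemma S00_wfun_zero_le {ν s ε : ℝ} (hνs : 0 ≤ ν * s) (hε : 0 < ε)
    (hsmall : ν * s * ε ^ 3 ≤ 1 / 63000) :
    mulOpEv (multS ν s ε) (wfun ε) 0 ≤ -(16 / 15) := by
  have hp : 0 < ε ^ 3 / 144 := by positivity
  have hq : 0 < 315 * ε ^ 3 := by positivity
  rw [show wfun ε = fun y => gfun (ε ^ 3 / 144) y - 2 * gfun (315 * ε ^ 3) y from rfl,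
    mulOp_twoScale_zero hp hq (measurable_multS_smul ν s ε) (abs_multS_le_one hνs hε.le),
    integral_multS_ghat hνs hε.le hp, integral_multS_ghat hνs hε.le hq]
  linarith [avg_multB_wide_le hνs hε, avg_multB_narrow_ge hνs hε hsmall]

/-- The skeleton's `mulOp (symbS ν s ε 0 0)` is `mulOpEv (multS ν s ε)` (even multiplier). -/
lemma mulOp_symbS00_eq (ν s ε : ℝ) (φ : E3 → ℝ) :
    mulOp (symbS ν s ε 0 0) φ = mulOpEv (multS ν s ε) φ := by
  funext x
  rw [symbS00_eq, mulOp_eq_of_even (multS_even ν s ε)]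
  rfl

/-! ### Theorem 6.3: (6.58)/(6.59) p. 143 -/

/-- **(6.58) fails** for the entry `S_00`: for every `ν ≥ 0`, `ε > 0`, lag `s ≥ 0` with
`ν s ε³ ≤ 1/63000`, `‖w‖₀ ≤ 1 < 16/15 ≤ |(S_00 w)(0)| ≤ ‖S_00 w‖₀`.
[cite: TsionskiyTsionskiy2025, Thm 6.3 (6.58) p.143] -/
theorem eq658_fails {ν ε s : ℝ} (hν : 0 ≤ ν) (hε : 0 < ε) (hs : 0 ≤ s)
    (hsmall : ν * s * ε ^ 3 ≤ 1 / 63000) :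
    supNorm (wfun ε) < supNorm (mulOp (symbS ν s ε 0 0) (wfun ε)) := by
  have hνs : 0 ≤ ν * s := mul_nonneg hν hs
  have h1 : supNorm (wfun ε) ≤ 1 := supNorm_le (abs_wfun_le_one hε)
  have h2 : 16 / 15 ≤ |mulOp (symbS ν s ε 0 0) (wfun ε) 0| := by
    rw [mulOp_symbS00_eq]
    have := S00_wfun_zero_le hνs hε hsmall
    rw [abs_of_nonpos (by linarith)]; linarith
  have h3 : |mulOp (symbS ν s ε 0 0) (wfun ε) 0| ≤ supNorm (mulOp (symbS ν s ε 0 0) (wfun ε)) := by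
    rw [mulOp_symbS00_eq]; exact abs_mulOp_le_supNorm _ _ 0
  linarith

/-- Smallness of the closed instance `ν = 1`, `ε = e^{−2}`, lag `s = t − t* = e^{−6}/2`. -/
lemma smallness_instance_half :
    (1:ℝ) * (Real.exp (-6) - Real.exp (-6) / 2) * Real.exp (-2) ^ 3 ≤ 1 / 63000 := by
  have h := smallness_instance
  have h6 : 0 < Real.exp (-6) := Real.exp_pos _
  have h2 : 0 < Real.exp (-2) ^ 3 := pow_pos (Real.exp_pos _) 3
  nlinarith

/-- The vector witness for (6.59): `f⃗ = (w, 0, 0)`. -/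
def fvec (ε : ℝ) : Fin 3 → E3 → ℝ := fun j => if j = 0 then wfun ε else 0

/-- The zero function is in `S`. -/
lemma inS_zero : InS (0 : E3 → ℝ) := by
  have h : ((0 : 𝓢(E3, ℝ)) : E3 → ℝ) = 0 := by ext x; simp
  rw [← h]; exact inS_schwartz 0

/-- The multiplier operator kills the zero function. -/
lemma mulOp_zero_fun (m : E3 → ℝ) (x : E3) : mulOp m (0 : E3 → ℝ) x = 0 := by
  unfold mulOp
  have h1 : (fun y : E3 => (((0 : E3 → ℝ) y : ℝ) : ℂ)) = 0 := by funext y; simp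
  have h2 : 𝓕 (0 : E3 → ℂ) = 0 := by
    ext w; simp [Real.fourier_eq]
  rw [h1, h2]
  have h3 : (fun ξ : E3 => ((m (-((2 * π) • ξ)) : ℝ) : ℂ) * (0 : E3 → ℂ) ξ) = 0 := by
    funext ξ; simp
  rw [h3]
  have h4 : 𝓕⁻ (0 : E3 → ℂ) = 0 := by
    ext w; simp [Real.fourierInv_eq]
  rw [h4]; simp

/-- The sup-norm of the zero function vanishes. -/
lemma supNorm_zero : supNorm (0 : E3 → ℝ) = 0 := by simp [supNorm]

/-- `(S̿ᵗ f⃗)_0 = S_00 w` for `f⃗ = (w, 0, 0)`. -/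
lemma opSt_fvec_zero (ν t tstar ε : ℝ) :
    opSt ν t tstar ε (fvec ε) 0 = mulOp (symbS ν (t - tstar) ε 0 0) (wfun ε) := by
  funext x
  simp only [opSt, fvec, Fin.sum_univ_three, Fin.isValue, if_true,
    show ((1 : Fin 3) = 0) = False by decide, show ((2 : Fin 3) = 0) = False by decide,
    if_false, mulOp_zero_fun, add_zero]

/-- `|f⃗| = ‖w‖₀` for `f⃗ = (w, 0, 0)`. -/
lemma vecNorm_fvec (ε : ℝ) : vecNorm (fvec ε) = supNorm (wfun ε) := by
  simp only [vecNorm, fvec, Fin.sum_univ_three, Fin.isValue, if_true,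
    show ((1 : Fin 3) = 0) = False by decide, show ((2 : Fin 3) = 0) = False by decide,
    if_false, supNorm_zero, add_zero]

/-- The vector instance `f⃗ = (w, 0, 0)` of (6.59): `|S̿ᵗ f⃗| ≥ ‖S_00 w‖₀ ≥ 16/15 > 1 ≥ |f⃗|`.
[cite: TsionskiyTsionskiy2025, Thm 6.3 (6.59) p.143] -/
theorem step5_fails {ν ε t tstar : ℝ} (hν : 0 ≤ ν) (hε : 0 < ε) (hts : tstar ≤ t)
    (hsmall : ν * (t - tstar) * ε ^ 3 ≤ 1 / 63000) :
    ¬ vecNorm (opSt ν t tstar ε (fvec ε)) < vecNorm (fvec ε) := by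
  intro hlt
  have h0 := eq658_fails hν hε (sub_nonneg.mpr hts) hsmall
  have h1 : supNorm (opSt ν t tstar ε (fvec ε) 0) ≤ vecNorm (opSt ν t tstar ε (fvec ε)) := by
    simp only [vecNorm, Fin.sum_univ_three]
    linarith [supNorm_nonneg (opSt ν t tstar ε (fvec ε) 1),
      supNorm_nonneg (opSt ν t tstar ε (fvec ε) 2)]
  rw [opSt_fvec_zero] at h1
  rw [vecNorm_fvec] at hlt
  linarith

end Toolkit

/-! ### The two headline refutations (skeleton names fully qualified) -/

/-- **`¬ Eq658`** — the scalar diagonal form (6.58) p. 143 of Theorem 6.3 is false: instance `ν = 1`,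
`ε = e^{−2}`, `t = e^{−6}`, `t* = e^{−6}/2`, `i = 1` (index `0`), `f_i = w`.
[cite: TsionskiyTsionskiy2025, Thm 6.3 (6.58) p.143] -/
theorem not_Eq658 : ¬ Literature.Claims.NS.Tsionskiy2025.Eq658 := by
  intro h
  have hε : (0:ℝ) < Real.exp (-2) := Real.exp_pos _
  have h6 : (0:ℝ) < Real.exp (-6) := Real.exp_pos _
  have hlt := h 1 zero_le_one (Real.exp (-2)) hε le_rfl (Real.exp (-6)) h6
    exp_neg_six_le_exp_neg_two (Real.exp (-6) / 2) (by positivity) (by linarith) 0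
    (wfun (Real.exp (-2))) (inS_wfun hε) ⟨0, by rw [wfun_zero]; norm_num⟩
  exact absurd hlt (not_lt.mpr (eq658_fails zero_le_one hε (by linarith)
    smallness_instance_half).le)

/-- **`¬ Step_5`** — Theorem 6.3, (6.59) p. 143 «|S̿ᵗ·f⃗| < |f⃗|, f⃗ ∈ →TS» is false: instance `ν = 1`,
`ε = e^{−2}`, `t = e^{−6}`, `t* = e^{−6}/2`, `f⃗ = (w, 0, 0)` with
`w(x) = e^{−(ε³/144)|x|²} − 2e^{−315ε³|x|²}`; the entry `S_00 = F⁻¹[χ₀₀ e^{−ν|γ|²(t−t*)} δ F·]` alone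
has `|(S_00 w)(0)| ≥ (2/3)·(8/5) = 16/15 > 1 = ‖w‖₀` (direction average of `χ₀₀ = 1 − γ₀²/|γ|²` over the
radial symbol is `2/3`). Class: false lemma (countermodel). [cite: TsionskiyTsionskiy2025, Thm 6.3 (6.59) p.143] -/
theorem not_Step_5 : ¬ Literature.Claims.NS.Tsionskiy2025.Step_5 := by
  intro h
  have hε : (0:ℝ) < Real.exp (-2) := Real.exp_pos _
  have h6 : (0:ℝ) < Real.exp (-6) := Real.exp_pos _
  refine step5_fails (ν := 1) (t := Real.exp (-6)) (tstar := Real.exp (-6) / 2) zero_le_one hε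
    (by linarith) smallness_instance_half ?_
  refine h 1 zero_le_one (Real.exp (-2)) hε le_rfl (Real.exp (-6)) h6 exp_neg_six_le_exp_neg_two
    (Real.exp (-6) / 2) (by positivity) (by linarith) (fvec (Real.exp (-2))) (fun j => ?_)
    ⟨0, 0, by simp [fvec, wfun_zero]⟩
  by_cases hj : j = 0
  · simp only [fvec, hj, if_true]; exact inS_wfun hε
  · simp only [fvec, if_neg hj]; exact inS_zero

end Summit.NavierStokesRegularity.NavierStokesRegularity.Theorems.Tsionskiy2025

end
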